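import Mathlib.Data.Nat.Choose.Sum
import Mathlib.Data.Real.Basic
import Mathlib.Order.Interval.Finset.Nat
import Mathlib.Tactic.FieldSimp
import Mathlib.Tactic.GCongr
import Mathlib.Tactic.Linarith
import Mathlib.Tactic.Positivity
import Mathlib.Tactic.Ring
import Literature.InformationTheory.Coding.HammingBall
import HarnessLib

/-!
# The largest ballot number (two-row degree) is at most `4 · 2ⁿ / n`

Topic `Combinatorics/Enumerative`; proved theorems only (no definitions, no named facts).

The ballot number `f^{(n-j,j)} = C(n,j) - C(n,j-1) = C(n,j) · (n - 2j + 1)/(n - j + 1)`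
(`0 ≤ 2j ≤ n`) is the number of standard Young tableaux of the two-row shape `(n-j, j)`, i.e. the
degree of the two-row irreducible representation of the symmetric group `𝔖ₙ` (hook length
formula), equivalently the number of lattice paths with `n - j` up- and `j` down-steps staying weakly
above the axis (Bertrand's ballot problem). Its maximum over `j` is of exact order `2ⁿ / n`
(attained for `n - 2j ≍ √n`). This file proves the uniform upper bound with an explicit constant,

* `ballot_le_four_mul_two_pow_div` : `C(n,j) · (n - 2j + 1) / (n - j + 1) ≤ 4 · 2ⁿ / n`
  for all `n ≥ 1`, `2j ≤ n` (real form),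

from two counting inequalities on binomial coefficients which are of independent use,

* `choose_mul_half_succ_sub_le_two_pow` : `C(n,j) · (⌊n/2⌋ + 1 - j) ≤ 2ⁿ`;
* `choose_mul_succ_sub_two_mul_le_two_pow` : `C(n,j) · (n + 1 - 2j) ≤ 2ⁿ⁺¹`.

## Proof

Unimodality below the middle (`Literature.InformationTheory.Coding.choose_le_choose_of_le_half`,
iterating Mathlib's `Nat.choose_le_succ_of_lt_half_left`): each of the `⌊n/2⌋ + 1 - j` coefficients
`C(n,i)`, `j ≤ i ≤ ⌊n/2⌋`, is at least `C(n,j)`, and all of them together are at most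
`Σ_i C(n,i) = 2ⁿ` (`Nat.sum_range_choose`); so `C(n,j) (⌊n/2⌋ + 1 - j) ≤ 2ⁿ`, whence
`C(n,j) (n + 1 - 2j) ≤ 2ⁿ⁺¹` as `n + 1 - 2j ≤ 2 (⌊n/2⌋ + 1 - j)`. Finally `n - j + 1 ≥ n/2` for
`2j ≤ n`, so the ballot number is at most `2ⁿ⁺¹ / (n/2) = 4 · 2ⁿ / n`.

## What is NOT here

The identification with `numStandardTableaux` of a two-row partition / with differences of binomial
coefficients (users state the quotient form directly, as the symmetric-group design routes of
`Summits/MatrixMultiplication` do), the matching lower bound `max_j f^{(n-j,j)} ≥ c · 2ⁿ / n`, and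
the Gaussian-regime asymptotics.

## References

Folklore. For the hook length / ballot formula `f^{(n-j,j)} = C(n,j)(n-2j+1)/(n-j+1)` see e.g.
M. Aigner, *A Course in Enumeration* (GTM 238, Springer 2007), §3.1, Exercise 3.10 [Aigner2007];
the `2ⁿ/n` order of the maximum is the standard local-limit heuristic for the discrete derivative
of the binomial distribution.
-/

namespace Literature.Combinatorics.Enumerative

open Finset

/-- Counting form of unimodality: `C(n,j) · (⌊n/2⌋ + 1 - j) ≤ 2ⁿ` — the `⌊n/2⌋ + 1 - j` binomial
coefficients `C(n,i)`, `j ≤ i ≤ ⌊n/2⌋`, are each at least `C(n,j)` and together at most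
`Σ_i C(n,i) = 2ⁿ`. (Trivial when `j > ⌊n/2⌋`: the factor is `0`.) [folklore] -/
theorem choose_mul_half_succ_sub_le_two_pow (n j : ℕ) : n.choose j * (n / 2 + 1 - j) ≤ 2 ^ n := by
  calc n.choose j * (n / 2 + 1 - j)
      = ∑ _i ∈ Ico j (n / 2 + 1), n.choose j := by
        rw [sum_const, Nat.card_Ico, smul_eq_mul, mul_comm]
    _ ≤ ∑ i ∈ Ico j (n / 2 + 1), n.choose i :=
        sum_le_sum fun i hi =>
          Literature.InformationTheory.Coding.choose_le_choose_of_le_half (mem_Ico.1 hi).1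
            (Nat.lt_succ_iff.1 (mem_Ico.1 hi).2)
    _ ≤ ∑ i ∈ range (n + 1), n.choose i :=
        sum_le_sum_of_subset_of_nonneg
          (fun i hi => mem_range.2 (by have := (mem_Ico.1 hi).2; omega))
          (fun _ _ _ => Nat.zero_le _)
    _ = 2 ^ n := Nat.sum_range_choose n

/-- The numerator of the ballot number is `O(2ⁿ)` uniformly in `j`:
`C(n,j) · (n + 1 - 2j) ≤ 2ⁿ⁺¹` (from `choose_mul_half_succ_sub_le_two_pow` and
`n + 1 - 2j ≤ 2 (⌊n/2⌋ + 1 - j)`). [folklore] -/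
theorem choose_mul_succ_sub_two_mul_le_two_pow (n j : ℕ) :
    n.choose j * (n + 1 - 2 * j) ≤ 2 ^ (n + 1) := by
  have h := choose_mul_half_succ_sub_le_two_pow n j
  have h2 : n + 1 - 2 * j ≤ 2 * (n / 2 + 1 - j) := by omega
  calc n.choose j * (n + 1 - 2 * j)
      ≤ n.choose j * (2 * (n / 2 + 1 - j)) := Nat.mul_le_mul_left _ h2
    _ = 2 * (n.choose j * (n / 2 + 1 - j)) := by ring
    _ ≤ 2 * 2 ^ n := Nat.mul_le_mul_left 2 h
    _ = 2 ^ (n + 1) := by ring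

/-- **The largest two-row degree is `O(2ⁿ/n)`**: for `n ≥ 1` and `2j ≤ n` the ballot number
`f^{(n-j,j)} = C(n,j) (n - 2j + 1)/(n - j + 1)` satisfies
`C(n,j) (n - 2j + 1)/(n - j + 1) ≤ 4 · 2ⁿ / n` (numerator `≤ 2ⁿ⁺¹` by
`choose_mul_succ_sub_two_mul_le_two_pow`, denominator `≥ n/2`). The order `2ⁿ/n` is sharp.
[folklore] -/
theorem ballot_le_four_mul_two_pow_div {n j : ℕ} (hn : 1 ≤ n) (hj : 2 * j ≤ n) :
    (n.choose j : ℝ) * ((n : ℝ) - 2 * j + 1) / ((n : ℝ) - j + 1) ≤ 4 * 2 ^ n / n := by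
  have hn0 : (0 : ℝ) < n := by exact_mod_cast hn
  have hjr : 2 * (j : ℝ) ≤ n := by exact_mod_cast hj
  -- numerator: `C(n,j) (n - 2j + 1) ≤ 2ⁿ⁺¹`, cast from `ℕ`
  have hnum : (n.choose j : ℝ) * ((n : ℝ) - 2 * j + 1) ≤ 2 ^ (n + 1) := by
    have h := choose_mul_succ_sub_two_mul_le_two_pow n j
    have hcast : ((n + 1 - 2 * j : ℕ) : ℝ) = (n : ℝ) - 2 * j + 1 := by
      rw [Nat.cast_sub (by omega)]
      push_cast
      ring
    rw [← hcast]
    exact_mod_cast h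
  -- denominator: `n - j + 1 ≥ n/2 > 0`
  have hden : (n : ℝ) / 2 ≤ (n : ℝ) - j + 1 := by linarith
  have hden0 : (0 : ℝ) < (n : ℝ) - j + 1 := by linarith
  rw [div_le_iff₀ hden0]
  calc (n.choose j : ℝ) * ((n : ℝ) - 2 * j + 1) ≤ 2 ^ (n + 1) := hnum
    _ = 4 * 2 ^ n / n * ((n : ℝ) / 2) := by
        field_simp
        ring
    _ ≤ 4 * 2 ^ n / n * ((n : ℝ) - j + 1) := by gcongr

end Literature.Combinatorics.Enumerative
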